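import Summits.BirchSwinnertonDyer.BirchSwinnertonDyer.Theorems.ManinLocalTwoThreeEtaUnitCubeNonMult
import Summits.BirchSwinnertonDyer.BirchSwinnertonDyer.Theorems.ManinLocalTwoThreeEtaUnitSquareIffEven
import HarnessLib

/-!
# E-an-56 `EtaUnitCubeIffThree`: an `η`-unit series is a `3`-adic cube iff all exponents are divisible by `3`

Summit `BirchSwinnertonDyer`, route `ManinLocalTwoThree` (cell bsd-f2-manin), crux C3 `ManinPrimeToThreeAtNine`
(stmt-BirchSwinnertonDyer-22968), the `W[3]`-reducible residual; an g14's support theorem E-an-56 (MEMO-an §56.12, leaf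
`Summit.BirchSwinnertonDyer.Rank1Residual.ManinAdditive.CuspidalKummerThree.EtaUnitCubeIffThree`, typer T-an-18 p610785;
REF1 §R50 «TRUE elementary»), the cube test of the cuspidal-Kummer certificate E-an-58.  Twin of `…EtaUnitSquareIffEven.lean`.

* `isCube_etaUnit_of_forall_three_dvd` — `⇐`: all `3 ∣ r_δ` ⟹ `g = (∏ E(q^δ)^{r_δ/3})³` already in `ℤ⟦q⟧`.
* `forall_three_dvd_of_isCube_etaUnit` — `⇒`, by strong induction on a bound of `S`: scales prime to `3` by
  `three_dvd_of_isCube_etaUnit_of_not_three_dvd`; for the scales divisible by `3` write `g·Q³ = P³·Φ` with `P, Q` the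
  `η`-products over the scales prime to `3` (cubes, their exponents being divisible by `3`) — then `Φ` is the unit series at the
  scales in `3ℕ`, is `3ℕ`-supported, is a `3`-adic cube, so its contraction `q³ ↦ q` is a `3`-adic cube
  (`isCube_contractThree_of_isCube`) and is the unit series of the scales divided by `3`: induct.
* **`etaUnitCubeIffThree`** — the body of the leaf with `IsEtaUnitSeries` unfolded (the leaf BY NAME is recorded in the
  sibling `…EtaUnitCubeIffThreeHolds.lean`, which imports the leaf file).

No new definitions; nothing about BSD or Manin's conjecture is proved here.

References: cell memo HOME/MEMO-an.md §56.12; T. M. Apostol, GTM 41 §3.1–§3.2 [cite: Apostol1990, §3.1–§3.2].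
-/

set_option autoImplicit false
set_option linter.dupNamespace false

open PowerSeries Literature.NumberTheory.EllipticCurves.ModularForms

namespace Summit.BirchSwinnertonDyer.BirchSwinnertonDyer.Theorems.ManinLocalTwoThree

noncomputable section

section Main

/-- `(3k)⁺ = 3·k⁺` (plumbing). [folklore] -/
theorem toNat_three_mul (k : ℤ) : (3 * k).toNat = 3 * k.toNat := by omega

/-- **E-an-56, `⇐`**: if all `r_δ` are divisible by `3` the `η`-unit series is a cube (already in `ℤ⟦q⟧`, hence `3`-adically).
[cite: Apostol1990, §3.1–§3.2] -/
theorem isCube_etaUnit_of_forall_three_dvd (S : Finset ℕ) (r : ℕ → ℤ) (g : PowerSeries ℤ)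
    (hg : constantCoeff g = 1 ∧
      g * ∏ δ ∈ S, formalEulerScaled δ ^ (-(r δ)).toNat = ∏ δ ∈ S, formalEulerScaled δ ^ (r δ).toNat)
    (hdvd : ∀ δ ∈ S, (3 : ℤ) ∣ r δ) : ∃ h : PowerSeries ℤ_[3], g.map (Int.castRingHom ℤ_[3]) = h ^ 3 := by
  -- `r = 3 k`
  let k : ℕ → ℤ := fun δ => r δ / 3
  have hk : ∀ δ ∈ S, r δ = 3 * k δ := fun δ hδ => by
    have := Int.ediv_mul_cancel (hdvd δ hδ); simp only [k]; rw [mul_comm]; exact this.symm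
  let P : PowerSeries ℤ := ∏ δ ∈ S, formalEulerScaled δ ^ (k δ).toNat
  let Q : PowerSeries ℤ := ∏ δ ∈ S, formalEulerScaled δ ^ (-(k δ)).toNat
  have hP : ∏ δ ∈ S, formalEulerScaled δ ^ (r δ).toNat = P ^ 3 := by
    rw [← Finset.prod_pow]
    refine Finset.prod_congr rfl fun δ hδ => ?_
    rw [← pow_mul, hk δ hδ, toNat_three_mul, mul_comm]
  have hQ : ∏ δ ∈ S, formalEulerScaled δ ^ (-(r δ)).toNat = Q ^ 3 := by
    rw [← Finset.prod_pow]
    refine Finset.prod_congr rfl fun δ hδ => ?_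
    rw [← pow_mul, hk δ hδ, show -(3 * k δ) = 3 * (-(k δ)) by ring, toNat_three_mul, mul_comm]
  have hQu : IsUnit Q := by
    rw [PowerSeries.isUnit_iff_constantCoeff]
    simp only [Q, constantCoeff_prod_formalEulerScaled_pow, isUnit_one]
  obtain ⟨u, hu⟩ := hQu
  have hid : g * Q ^ 3 = P ^ 3 := by rw [← hP, ← hQ]; exact hg.2
  have hcube : ∃ h : PowerSeries ℤ, g = h ^ 3 := by
    refine ⟨P * ↑u⁻¹, ?_⟩
    calc g = g * (Q * ↑u⁻¹) ^ 3 := by rw [← hu, Units.mul_inv, one_pow, mul_one]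
      _ = g * Q ^ 3 * (↑u⁻¹) ^ 3 := by ring
      _ = P ^ 3 * (↑u⁻¹) ^ 3 := by rw [hid]
      _ = (P * ↑u⁻¹) ^ 3 := by ring
  obtain ⟨h, hh⟩ := hcube
  exact ⟨h.map (Int.castRingHom ℤ_[3]), by rw [hh, map_pow]⟩

/-- **E-an-56, `⇒`** (strong induction on a bound `n` of the scales). [cite: Apostol1990, §3.1–§3.2] -/
theorem forall_three_dvd_of_isCube_etaUnit (n : ℕ) : ∀ (S : Finset ℕ) (r : ℕ → ℤ) (g : PowerSeries ℤ),
    (∀ δ ∈ S, δ ≤ n) → 0 ∉ S →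
    (constantCoeff g = 1 ∧
      g * ∏ δ ∈ S, formalEulerScaled δ ^ (-(r δ)).toNat = ∏ δ ∈ S, formalEulerScaled δ ^ (r δ).toNat) →
    (∃ h : PowerSeries ℤ_[3], g.map (Int.castRingHom ℤ_[3]) = h ^ 3) → ∀ δ ∈ S, (3 : ℤ) ∣ r δ := by
  induction n using Nat.strong_induction_on with
  | _ n ih =>
  intro S r g hle hS hg hcube δ hδS
  classical
  have hprime : ∀ d ∈ S, ¬ 3 ∣ d → (3 : ℤ) ∣ r d := three_dvd_of_isCube_etaUnit_of_not_three_dvd S r g hS hg hcube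
  by_cases hδ3 : 3 ∣ δ
  swap
  · exact hprime δ hδS hδ3
  -- `3 ∣ δ`: descent to the scales divided by `3`
  set S₁ : Finset ℕ := S.filter fun d => ¬ 3 ∣ d with hS₁
  set S₃ : Finset ℕ := S.filter fun d => ¬ ¬ 3 ∣ d with hS₃
  have hδS₃ : δ ∈ S₃ := Finset.mem_filter.mpr ⟨hδS, not_not.mpr hδ3⟩
  let E : ℕ → PowerSeries ℤ := formalEulerScaled
  -- the prime-to-`3` part is a cube on both sides
  let k : ℕ → ℤ := fun d => r d / 3
  have hk : ∀ d ∈ S₁, r d = 3 * k d := fun d hd => by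
    obtain ⟨hdS, hd3⟩ := Finset.mem_filter.mp hd
    have := Int.ediv_mul_cancel (hprime d hdS hd3); simp only [k]; rw [mul_comm]; exact this.symm
  let P : PowerSeries ℤ := ∏ d ∈ S₁, E d ^ (k d).toNat
  let Q : PowerSeries ℤ := ∏ d ∈ S₁, E d ^ (-(k d)).toNat
  have hP : ∏ d ∈ S₁, E d ^ (r d).toNat = P ^ 3 := by
    rw [← Finset.prod_pow]
    refine Finset.prod_congr rfl fun d hd => ?_
    rw [← pow_mul, hk d hd, toNat_three_mul, mul_comm]
  have hQ : ∏ d ∈ S₁, E d ^ (-(r d)).toNat = Q ^ 3 := by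
    rw [← Finset.prod_pow]
    refine Finset.prod_congr rfl fun d hd => ?_
    rw [← pow_mul, hk d hd, show -(3 * k d) = 3 * (-(k d)) by ring, toNat_three_mul, mul_comm]
  let A : PowerSeries ℤ := ∏ d ∈ S₃, E d ^ (-(r d)).toNat
  let B : PowerSeries ℤ := ∏ d ∈ S₃, E d ^ (r d).toNat
  have hsplitL : ∏ d ∈ S, E d ^ (-(r d)).toNat = Q ^ 3 * A := by
    rw [← hQ]; exact (Finset.prod_filter_mul_prod_filter_not S (fun d => ¬ 3 ∣ d) _).symm
  have hsplitR : ∏ d ∈ S, E d ^ (r d).toNat = P ^ 3 * B := by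
    rw [← hP]; exact (Finset.prod_filter_mul_prod_filter_not S (fun d => ¬ 3 ∣ d) _).symm
  have hPu : IsUnit P := by
    rw [PowerSeries.isUnit_iff_constantCoeff]
    simp only [P, E, constantCoeff_prod_formalEulerScaled_pow, isUnit_one]
  obtain ⟨u, hu⟩ := hPu
  -- `Φ := g Q³ / P³` is the unit series at the scales in `3ℕ`
  let Φ : PowerSeries ℤ := g * Q ^ 3 * (↑u⁻¹) ^ 3
  have hΦid : Φ * A = B := by
    have h1 : g * (Q ^ 3 * A) = P ^ 3 * B := by rw [← hsplitL, ← hsplitR]; exact hg.2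
    calc Φ * A = g * (Q ^ 3 * A) * (↑u⁻¹) ^ 3 := by ring
      _ = P ^ 3 * B * (↑u⁻¹) ^ 3 := by rw [h1]
      _ = B * (P * ↑u⁻¹) ^ 3 := by ring
      _ = B := by rw [← hu, Units.mul_inv, one_pow, mul_one]
  have hA0 : constantCoeff A = 1 := constantCoeff_prod_formalEulerScaled_pow S₃ _
  have hB0 : constantCoeff B = 1 := constantCoeff_prod_formalEulerScaled_pow S₃ _
  have hΦ0 : constantCoeff Φ = 1 := by
    have := congrArg constantCoeff hΦid
    rw [map_mul, hA0, mul_one, hB0] at this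
    exact this
  have h3S₃ : ∀ d ∈ S₃, 3 ∣ d := fun d hd => not_not.mp (Finset.mem_filter.mp hd).2
  have hA3 : ∀ i, ¬ 3 ∣ i → coeff i A = 0 :=
    vanishThree_prod S₃ _ fun d hd => vanishThree_pow (vanishThree_formalEulerScaled_of_three_dvd (h3S₃ d hd)) _
  have hB3 : ∀ i, ¬ 3 ∣ i → coeff i B = 0 :=
    vanishThree_prod S₃ _ fun d hd => vanishThree_pow (vanishThree_formalEulerScaled_of_three_dvd (h3S₃ d hd)) _
  have hΦ3 : ∀ i, ¬ 3 ∣ i → coeff i Φ = 0 := vanishThree_of_mul_eq hA3 hA0 hB3 hΦid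
  -- contraction: the unit series `g'` of the scales divided by `3`
  let g' : PowerSeries ℤ := PowerSeries.mk fun m => coeff (3 * m) Φ
  let S' : Finset ℕ := S₃.image fun d => d / 3
  let r' : ℕ → ℤ := fun d' => r (3 * d')
  have hthree : ∀ d ∈ S₃, 3 * (d / 3) = d := fun d hd => Nat.mul_div_cancel' (h3S₃ d hd)
  have hinj : Set.InjOn (fun d => d / 3) (S₃ : Set ℕ) := by
    intro d₁ h₁ d₂ h₂ h
    have e₁ := hthree d₁ h₁; have e₂ := hthree d₂ h₂
    simp only at h
    omega
  have hcontr : ∀ (nn : ℕ → ℕ) (nn' : ℕ → ℕ), (∀ d ∈ S₃, nn d = nn' (d / 3)) →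
      (PowerSeries.mk fun m => coeff (3 * m) (∏ d ∈ S₃, E d ^ nn d)) = ∏ d' ∈ S', E d' ^ nn' d' := by
    intro nn nn' hnn
    rw [contractThree_prod S₃ _ (fun d hd => vanishThree_pow (vanishThree_formalEulerScaled_of_three_dvd (h3S₃ d hd)) _),
      Finset.prod_image hinj]
    refine Finset.prod_congr rfl fun d hd => ?_
    rw [contractThree_pow (vanishThree_formalEulerScaled_of_three_dvd (h3S₃ d hd)), hnn d hd]
    congr 1
    show (PowerSeries.mk fun m => coeff (3 * m) (formalEulerScaled d)) = formalEulerScaled (d / 3)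
    conv_lhs => rw [← hthree d hd]
    exact contractThree_formalEulerScaled_three_mul (d / 3)
  have hg' : constantCoeff g' = 1 ∧
      g' * ∏ d' ∈ S', formalEulerScaled d' ^ (-(r' d')).toNat = ∏ d' ∈ S', formalEulerScaled d' ^ (r' d').toNat := by
    refine ⟨?_, ?_⟩
    · show constantCoeff (PowerSeries.mk fun m => coeff (3 * m) Φ) = 1
      rw [← coeff_zero_eq_constantCoeff_apply, coeff_mk, mul_zero, coeff_zero_eq_constantCoeff_apply, hΦ0]
    · have h1 : (PowerSeries.mk fun m => coeff (3 * m) (Φ * A)) = PowerSeries.mk fun m => coeff (3 * m) B := by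
        rw [hΦid]
      rw [contractThree_mul hΦ3] at h1
      have hL := hcontr (fun d => (-(r d)).toNat) (fun d' => (-(r' d')).toNat)
        (fun d hd => by simp only [r']; rw [hthree d hd])
      have hR := hcontr (fun d => (r d).toNat) (fun d' => (r' d').toNat)
        (fun d hd => by simp only [r']; rw [hthree d hd])
      rw [hL, hR] at h1
      exact h1
  have hS' : 0 ∉ S' := by
    intro h0
    obtain ⟨d, hd, hd0⟩ := Finset.mem_image.mp h0
    have hdS : d ∈ S := (Finset.mem_filter.mp hd).1
    have hdne : d ≠ 0 := fun h => hS (h ▸ hdS)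
    have := hthree d hd
    omega
  -- the bound shrinks: all `d' ≤ n / 3 < n`
  have hn3 : 3 ≤ n := by
    have hδ0 : δ ≠ 0 := fun h => hS (h ▸ hδS)
    have := hthree δ hδS₃
    have := hle δ hδS
    omega
  have hlt : n / 3 < n := Nat.div_lt_self (by omega) (by norm_num)
  have hle' : ∀ d' ∈ S', d' ≤ n / 3 := by
    intro d' hd'
    obtain ⟨d, hd, rfl⟩ := Finset.mem_image.mp hd'
    exact Nat.div_le_div_right (hle d (Finset.mem_filter.mp hd).1)
  -- `g'` is a `3`-adic cube
  have hcube' : ∃ h : PowerSeries ℤ_[3], g'.map (Int.castRingHom ℤ_[3]) = h ^ 3 := by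
    let ι := Int.castRingHom ℤ_[3]
    obtain ⟨H, hH⟩ := hcube
    have hΦcube : ∃ H' : PowerSeries ℤ_[3], Φ.map ι = H' ^ 3 := by
      refine ⟨H * PowerSeries.map ι Q * PowerSeries.map ι ((u⁻¹ : (PowerSeries ℤ)ˣ) : PowerSeries ℤ), ?_⟩
      show PowerSeries.map ι (g * Q ^ 3 * ((u⁻¹ : (PowerSeries ℤ)ˣ) : PowerSeries ℤ) ^ 3) = _
      rw [map_mul, map_mul, map_pow, map_pow, hH]; ring
    have hΦι0 : constantCoeff (Φ.map ι) = 1 := by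
      rw [← coeff_zero_eq_constantCoeff_apply, coeff_map, coeff_zero_eq_constantCoeff_apply, hΦ0, map_one]
    have := isCube_contractThree_of_isCube (vanishThree_map ι hΦ3) hΦι0 hΦcube
    rw [contractThree_map] at this
    exact this
  -- induct
  have hIH := ih (n / 3) hlt S' r' g' hle' hS' hg' hcube' (δ / 3) (Finset.mem_image.mpr ⟨δ, hδS₃, rfl⟩)
  simp only [r'] at hIH
  rwa [hthree δ hδS₃] at hIH

/-- **E-an-56 `EtaUnitCubeIffThree`** (an g14, MEMO-an §56.12; the body of the leaf with `IsEtaUnitSeries S r g` unfolded): for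
`0 ∉ S` and the unit series `g ∈ 1 + qℤ⟦q⟧` of the `η`-quotient `∏_δ η(δτ)^{r_δ}` (`g · ∏_δ E(q^δ)^{(−r_δ)⁺} = ∏_δ E(q^δ)^{(r_δ)⁺}`,
`E(q^δ) = formalEulerScaled δ`), `g` is a cube in `ℤ₃⟦q⟧` iff every `r_δ` is divisible by `3`. [cite: Apostol1990, §3.1–§3.2] -/
theorem etaUnitCubeIffThree :
    ∀ (S : Finset ℕ) (r : ℕ → ℤ) (g : PowerSeries ℤ), 0 ∉ S →
      (constantCoeff g = 1 ∧
        g * ∏ δ ∈ S, formalEulerScaled δ ^ (-(r δ)).toNat = ∏ δ ∈ S, formalEulerScaled δ ^ (r δ).toNat) →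
      ((∃ h : PowerSeries ℤ_[3], g.map (Int.castRingHom ℤ_[3]) = h ^ 3) ↔ ∀ δ ∈ S, (3 : ℤ) ∣ r δ) :=
  fun S r g hS hg =>
    ⟨fun hcube => forall_three_dvd_of_isCube_etaUnit (S.sup id) S r g (fun _ hδ => Finset.le_sup (f := id) hδ) hS hg hcube,
      isCube_etaUnit_of_forall_three_dvd S r g hg⟩

end Main

end

end Summit.BirchSwinnertonDyer.BirchSwinnertonDyer.Theorems.ManinLocalTwoThree
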